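import Mathlib
import Summits.Ventures.PercRepro2.SwOutCube

/-!
# Boundary (iv), the abstract cube of a two-vertex dropped component with a cross edge: vocabulary
(blind cell PercRepro2, night-4 g23, 2026-08-28; proofs/NIGHT4-G23.md §5–§6)

The junction `u` with the u-arms `U j` (`j : ι`) and TWO dropped vertices `p₁, p₂`, both joined to
`u`, joined to each other by the CROSS EDGE `c`, each with its outside edges — no pieces.  A point
of the raw cube is `(s, w)`: the u-arm bits `s : Config ι` and the FIBRE point
`w = (uP₁, uP₂, c, e₁, e₂)` (`Fib`).  Attachment is transitive through the cross edge
(`Fib.att₁ = uP₁ ∨ (c ∧ uP₂)`); the leak is per vertex (`LeakX`: an attached vertex on the side of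
`u` whose outside edges have the other colour); the red edge set of the cluster of `h` is a set of
ATOMS (`AtomX`: the u-arms, `u`, `p₁`, `p₂`, the cross edge) — `ER`; `EB = ER ∘ flipX`.  THE TYPE of
a point (`typX`): the u-arm bits and the LABEL of the fibre (`Fib.label`: the outside bits and, when
both outside bits agree, the LINK — `p₁, p₂` joined in red inside the structure when `e = 00`, in
blue when `e = 11`); the order `Better` («more red connectivity, less blue connectivity of the
outside through the structure»).  The conditioning of a class pulls back to an up-set of types
(census, NIGHT4-G23.md §5(c)); the abstract theorem (`SwOutCrossThm`) is the inequality on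
`QX 𝒯` for every up-set `𝒯` of types.
-/

namespace Summit.Ventures.PercRepro2

namespace CrossArm

/-- A point of the fibre: the u–`p₁` edge, the u–`p₂` edge, the cross edge, the outside edges of
`p₁`, the outside edges of `p₂` (`true` = red = as at the base for the u–p and cross edges, blue for
the outside edges). -/
structure Fib where
  /-- the u–`p₁` edge -/
  uP₁ : Bool
  /-- the u–`p₂` edge -/
  uP₂ : Bool
  /-- the cross edge -/
  c : Bool
  /-- the outside edges of `p₁` -/
  e₁ : Bool
  /-- the outside edges of `p₂` -/
  e₂ : Bool
  deriving DecidableEq, Fintype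

/-- The flip of a fibre point. -/
def Fib.flip (w : Fib) : Fib := ⟨!w.uP₁, !w.uP₂, !w.c, !w.e₁, !w.e₂⟩

/-- `p₁` is attached to `u` (directly or through the cross edge and `p₂`). -/
def Fib.att₁ (w : Fib) : Bool := w.uP₁ || (w.c && w.uP₂)

/-- `p₂` is attached to `u`. -/
def Fib.att₂ (w : Fib) : Bool := w.uP₂ || (w.c && w.uP₁)

/-- The cross edge lies in the cluster of `u`: red, with an attachment. -/
def Fib.attC (w : Fib) : Bool := w.c && (w.uP₁ || w.uP₂)

/-- The red-side leak of the fibre (meaningful when `u` is in the red cluster of `h`): an attached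
vertex with red outside edges. -/
def Fib.LeakR (w : Fib) : Bool := (w.att₁ && !w.e₁) || (w.att₂ && !w.e₂)

/-- The blue-side leak: the red-side leak of the flip. -/
def Fib.LeakB (w : Fib) : Bool := w.flip.LeakR

/-- The core fibre points: both vertices attached with blue outside edges, or both dropped with red
outside edges (the cross edge free). -/
def Fib.Core (w : Fib) : Bool := (w.uP₁ == w.uP₂) && (w.e₁ == w.uP₁) && (w.e₂ == w.uP₁)

/-- The label of a fibre point: the outside bits and the link. -/
structure Label where
  /-- the outside bit of `p₁` -/
  e₁ : Bool
  /-- the outside bit of `p₂` -/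
  e₂ : Bool
  /-- the link: `p₁, p₂` joined in red inside the structure (`e = 00`) / in blue (`e = 11`);
  `false` otherwise -/
  link : Bool
  deriving DecidableEq, Fintype

/-- The label of a fibre point. -/
def Fib.label (w : Fib) : Label :=
  ⟨w.e₁, w.e₂,
    if w.e₁ = false ∧ w.e₂ = false then w.c || (w.uP₁ && w.uP₂)
    else if w.e₁ = true ∧ w.e₂ = true then !w.c || (!w.uP₁ && !w.uP₂) else false⟩

/-- `l'` is at least as good a label as `l`: outside bits no larger; for equal outside bits, a red
link is better at `e = 00` and a blue link worse at `e = 11`. -/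
def Label.Better (l' l : Label) : Prop :=
  (l.e₁ = false → l'.e₁ = false) ∧ (l.e₂ = false → l'.e₂ = false) ∧
    (l'.e₁ = l.e₁ → l'.e₂ = l.e₂ →
      (l.e₁ = false → l.e₂ = false → l.link = true → l'.link = true) ∧
      (l.e₁ = true → l.e₂ = true → l'.link = true → l.link = true))

/-- `Label.Better` is decidable (the finite checks below). -/
instance (l' l : Label) : Decidable (Label.Better l' l) := by unfold Label.Better; infer_instance

/-- `Better` is reflexive on labels. -/
lemma Label.Better_refl : ∀ l : Label, Label.Better l l := by decide

/-- The four core fibre points: `a` (dropped, cross edge red), `b` (dropped, cross edge blue),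
`d` (attached, cross edge red), `f` (attached, cross edge blue). -/
def wa : Fib := ⟨false, false, true, false, false⟩
/-- The core fibre point `b`. -/
def wb : Fib := ⟨false, false, false, false, false⟩
/-- The core fibre point `d`. -/
def wd : Fib := ⟨true, true, true, true, true⟩
/-- The core fibre point `f`. -/
def wf : Fib := ⟨true, true, false, true, true⟩

section Points

variable (ι : Type*)

/-- A point of the raw cube: the u-arm bits and the fibre point. -/
abbrev PtX := Config ι × Fib

/-- The atoms: the u-arms, `u`, `p₁`, `p₂`, the cross edge. -/
inductive AtomX where
  /-- a u-arm -/
  | arm : ι → AtomX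
  /-- the junction -/
  | u : AtomX
  /-- the first dropped vertex -/
  | p₁ : AtomX
  /-- the second dropped vertex -/
  | p₂ : AtomX
  /-- the cross edge -/
  | cross : AtomX

/-- The type of a point: the u-arm bits and the label of the fibre. -/
abbrev TypX := Config ι × Label

variable {ι}

/-- Some u-arm is red: `u` lies in the red cluster of `h`. -/
def redU (s : Config ι) : Prop := ∃ j, s j = true

/-- Some u-arm is blue: `u` lies in the blue cluster of `h`. -/
def blueU (s : Config ι) : Prop := ∃ j, s j = false

/-- The leak of a point: on the side of `u` an attached vertex whose outside edges have the other
colour. -/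
def LeakX (q : PtX ι) : Prop :=
  (redU q.1 ∧ q.2.LeakR = true) ∨ (blueU q.1 ∧ q.2.LeakB = true)

/-- The red atoms of a point: the red u-arms, `u` when some u-arm is red, the attached vertices and
the cross edge when `u` is red. -/
def ER (q : PtX ι) : Set (AtomX ι) := fun a =>
  match a with
  | AtomX.arm j => q.1 j = true
  | AtomX.u => redU q.1
  | AtomX.p₁ => redU q.1 ∧ q.2.att₁ = true
  | AtomX.p₂ => redU q.1 ∧ q.2.att₂ = true
  | AtomX.cross => redU q.1 ∧ q.2.attC = true

/-- The total flip of a point. -/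
def flipX (q : PtX ι) : PtX ι := (flipAll q.1, q.2.flip)

/-- The blue atoms of a point: the red atoms of the flip. -/
def EB (q : PtX ι) : Set (AtomX ι) := ER (flipX q)

/-- The type of a point. -/
def typX (q : PtX ι) : TypX ι := (q.1, q.2.label)

/-- `t'` is at least as good a type as `t`: no more red u-arms (so more red hubs and fewer blue
hubs outside), and a better label. -/
def Better (t' t : TypX ι) : Prop :=
  (∀ j, t.1 j = false → t'.1 j = false) ∧ Label.Better t'.2 t.2

/-- An up-set of types. -/
def IsUpT (𝒯 : Set (TypX ι)) : Prop := ∀ t ∈ 𝒯, ∀ t', Better t' t → t' ∈ 𝒯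

section Finite

variable [Fintype ι] [DecidableEq ι]

open scoped Classical in
/-- The non-leaking points whose type lies in `𝒯`. -/
noncomputable def QX (𝒯 : Set (TypX ι)) : Finset (PtX ι) :=
  Finset.univ.filter fun q => ¬ LeakX q ∧ typX q ∈ 𝒯

end Finite

end Points

/-! ## Fibre facts (finite checks) -/

/-- The flip is an involution. -/
lemma Fib.flip_flip (w : Fib) : w.flip.flip = w := by
  cases w; simp [Fib.flip]

/-- A fibre point without red-side leak and without blue-side leak is a core point (the mixed
levels of the cube carry only core points). -/
lemma Fib.core_of_noLeak : ∀ w : Fib, w.LeakR = false → w.LeakB = false → w.Core = true := by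
  decide

/-- Core points never leak on the red side. -/
lemma Fib.leakR_eq_false_of_core : ∀ w : Fib, w.Core = true → w.LeakR = false := by decide

/-- Core points never leak on the blue side. -/
lemma Fib.leakB_eq_false_of_core : ∀ w : Fib, w.Core = true → w.LeakB = false := by decide

/-- The core points are `a, b, d, f`. -/
lemma Fib.eq_of_core : ∀ w : Fib, w.Core = true → w = wa ∨ w = wb ∨ w = wd ∨ w = wf := by decide

/-- The flips of the core points. -/
lemma wa_flip : wa.flip = wf := by decide
/-- The flips of the core points. -/
lemma wb_flip : wb.flip = wd := by decide
/-- The flips of the core points. -/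
lemma wd_flip : wd.flip = wb := by decide
/-- The flips of the core points. -/
lemma wf_flip : wf.flip = wa := by decide

/-- The core points are core. -/
lemma wa_core : wa.Core = true := by decide
/-- The core points are core. -/
lemma wb_core : wb.Core = true := by decide
/-- The core points are core. -/
lemma wd_core : wd.Core = true := by decide
/-- The core points are core. -/
lemma wf_core : wf.Core = true := by decide

/-- The chain of the core labels: `a` is better than `b`. -/
lemma label_wa_better_wb : Label.Better wa.label wb.label := by decide
/-- `b` is better than `d`. -/
lemma label_wb_better_wd : Label.Better wb.label wd.label := by decide
/-- `d` is better than `f`. -/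
lemma label_wd_better_wf : Label.Better wd.label wf.label := by decide
/-- `a` is better than `f`. -/
lemma label_wa_better_wf : Label.Better wa.label wf.label := by decide

/-- The attachment data of the core points: `a` and `b` have none. -/
lemma wa_att : wa.att₁ = false ∧ wa.att₂ = false ∧ wa.attC = false := by decide
/-- The attachment data of the core points. -/
lemma wb_att : wb.att₁ = false ∧ wb.att₂ = false ∧ wb.attC = false := by decide
/-- The attachment data of the core points: `d` has both vertices and the cross edge. -/
lemma wd_att : wd.att₁ = true ∧ wd.att₂ = true ∧ wd.attC = true := by decide
/-- The attachment data of the core points: `f` has both vertices, not the cross edge. -/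
lemma wf_att : wf.att₁ = true ∧ wf.att₂ = true ∧ wf.attC = false := by decide

end CrossArm

end Summit.Ventures.PercRepro2
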